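import Mathlib
import HarnessLib
import HarnessLib.Audit
import Summits.CriticalPhenomena.Statement
import Literature.Probability.LatticeModels.RandomCurrents
import Summits.CriticalPhenomena.Ising3DConformalLimit.Theorems.FKParityRobustnessFarMergingGivesU4

/-!
Route: EnergyNotSigmaSquared

DORMANT since 2026-09-03T10:19:17Z (reconciler: no traction for 5 d (last activity statement-checked at 2026-08-29T09:16:15Z); parked, not closed — `ledger route dormant route-CriticalPhenomena-EnergyNotSigmaSquared --off` to reactivate) — unstaffed, not closed; items shared with open routes are served there. `ledger route dormant <id> --off` reactivates.

# Route EnergyNotSigmaSquared — epsilon is not sigma squared — adjacent-source current avoidance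
decays as a power on Z^3 and cross-scale decoupling transfers it to far merging, forcing U4 nonzero

It suffices to show X = (GAP) ∧ (TRANSFER) ∧ (GLUE) ∧ (ML), realising card energy-not-sigma-squared
("ε is not σ²").
(GAP) EnergyGapPowerLaw: the truncated critical energy–energy correlation on ℤ³ is polynomially
smaller than the square of
the spin two-point function, ⟨σ₀σ_e₂ ; σ_xσ_x+e₂⟩_β_c ≤ C‖x‖^-κ ⟨σ₀σ_x⟩²_β_c for some κ > 0 — by the
exact random-current
factorisation (support item EnergyFactorisation) this says that two independent sourced critical
currents leaving the
ADJACENT sources 0, e₂ towards far targets avoid each other with probability ≤ C‖x‖^-κ; in exponents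
Δ_ε > 2Δ_σ strictly
(predicted κ = 2(Δ_ε − 2Δ_σ) ≈ 0.753). (TRANSFER) GapForcesFarMerging: such a power law forces FAR
merging — for some
fixed lattice quadruple shape x and some c > 0, along infinitely many dilations L, the lattice
Ursell function obeys
U₄(Lx) ≤ −c ⟨σ_Lx₀σ_Lx₁⟩⟨σ_Lx₂σ_Lx₃⟩ (Aizenman's intersection criterion at macroscopic separation,
on a subsequence of
scales). (GLUE) FarMergingGivesU4 (support, provable now): the renormalisation-free ratio U₄/(S₂S₂)
passes to any pointwise
scaling limit, giving item stmt-CriticalPhenomena-0636 verbatim (every non-degenerate pointwise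
limit has U₄ ≢ 0).
(ML) MoebiusLimit = item 1344 verbatim, the conjunct minus clause (iii), imported from the
covariance routes.
Lean: `(∃ κ C : ℝ, 0 < κ ∧ ∀ x : Literature.Probability.LatticeModels.Site 3, x ≠ 0 →
Literature.Probability.LatticeModels.criticalCorr 3 4 ![0, (Pi.single 1 1 :
Literature.Probability.LatticeModels.Site 3), x, x + Pi.single 1 1] -
Literature.Probability.LatticeModels.criticalCorr 3 2 ![0, (Pi.single 1 1 :
Literature.Probability.LatticeModels.Site 3)] * Literature.Probability.LatticeModels.criticalCorr 3
2 ![x, x + Pi.single 1 1] ≤ C * (‖x‖ : ℝ) ^ (-κ) *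
Literature.Probability.LatticeModels.criticalTwoPoint 3 x ^ 2) ∧ ((∃ κ C : ℝ, 0 < κ ∧ ∀ x :
Literature.Probability.LatticeModels.Site 3, x ≠ 0 →
Literature.Probability.LatticeModels.criticalCorr 3 4 ![0, (Pi.single 1 1 :
Literature.Probability.LatticeModels.Site 3), x, x + Pi.single 1 1] -
Literature.Probability.LatticeModels.criticalCorr 3 2 ![0, (Pi.single 1 1 :
Literature.Probability.LatticeModels.Site 3)] * Literature.Probability.LatticeModels.criticalCorr 3
2 ![x, x + Pi.single 1 1] ≤ C * (‖x‖ : ℝ) ^ (-κ) *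
Literature.Probability.LatticeModels.criticalTwoPoint 3 x ^ 2) → (∃ c : ℝ, 0 < c ∧ ∃ x : Fin 4 →
Literature.Probability.LatticeModels.Site 3, Function.Injective x ∧ ∀ L₀ : ℕ, ∃ L : ℕ, L₀ ≤ L ∧
Literature.Probability.LatticeModels.criticalCorr 3 4 (fun i => (L : ℤ) • x i) -
(Literature.Probability.LatticeModels.criticalCorr 3 2 ![(L : ℤ) • x 0, (L : ℤ) • x 1] *
Literature.Probability.LatticeModels.criticalCorr 3 2 ![(L : ℤ) • x 2, (L : ℤ) • x 3] +
Literature.Probability.LatticeModels.criticalCorr 3 2 ![(L : ℤ) • x 0, (L : ℤ) • x 2] *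
Literature.Probability.LatticeModels.criticalCorr 3 2 ![(L : ℤ) • x 1, (L : ℤ) • x 3] +
Literature.Probability.LatticeModels.criticalCorr 3 2 ![(L : ℤ) • x 0, (L : ℤ) • x 3] *
Literature.Probability.LatticeModels.criticalCorr 3 2 ![(L : ℤ) • x 1, (L : ℤ) • x 2]) ≤ -(c *
(Literature.Probability.LatticeModels.criticalCorr 3 2 ![(L : ℤ) • x 0, (L : ℤ) • x 1] *
Literature.Probability.LatticeModels.criticalCorr 3 2 ![(L : ℤ) • x 2, (L : ℤ) • x 3])))) ∧ ((∃ c :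
ℝ, 0 < c ∧ ∃ x : Fin 4 → Literature.Probability.LatticeModels.Site 3, Function.Injective x ∧ ∀ L₀ :
ℕ, ∃ L : ℕ, L₀ ≤ L ∧ Literature.Probability.LatticeModels.criticalCorr 3 4 (fun i => (L : ℤ) • x i)
- (Literature.Probability.LatticeModels.criticalCorr 3 2 ![(L : ℤ) • x 0, (L : ℤ) • x 1] *
Literature.Probability.LatticeModels.criticalCorr 3 2 ![(L : ℤ) • x 2, (L : ℤ) • x 3] +
Literature.Probability.LatticeModels.criticalCorr 3 2 ![(L : ℤ) • x 0, (L : ℤ) • x 2] *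
Literature.Probability.LatticeModels.criticalCorr 3 2 ![(L : ℤ) • x 1, (L : ℤ) • x 3] +
Literature.Probability.LatticeModels.criticalCorr 3 2 ![(L : ℤ) • x 0, (L : ℤ) • x 3] *
Literature.Probability.LatticeModels.criticalCorr 3 2 ![(L : ℤ) • x 1, (L : ℤ) • x 2]) ≤ -(c *
(Literature.Probability.LatticeModels.criticalCorr 3 2 ![(L : ℤ) • x 0, (L : ℤ) • x 1] *
Literature.Probability.LatticeModels.criticalCorr 3 2 ![(L : ℤ) • x 2, (L : ℤ) • x 3]))) → ∀ (ρ : ℝ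
→ ℝ) (S : Literature.Probability.LatticeModels.CorrFamily 3), (∀ δ ∈ Set.Ioc (0:ℝ) 1, 0 < ρ δ) →
Literature.Probability.LatticeModels.HasPointwiseScalingLimit
(Literature.Probability.LatticeModels.criticalCorr 3) ρ S →
Literature.Probability.LatticeModels.IsNondegenerateTwoPoint S →
Literature.Probability.LatticeModels.HasNontrivialU4 S) ∧ (∃ (ρ : ℝ → ℝ) (Δ : ℝ) (S :
Literature.Probability.LatticeModels.CorrFamily 3), (∀ δ ∈ Set.Ioc (0:ℝ) 1, 0 < ρ δ) ∧ 0 < Δ ∧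
Literature.Probability.LatticeModels.HasPointwiseScalingLimit
(Literature.Probability.LatticeModels.criticalCorr 3) ρ S ∧
Literature.Probability.LatticeModels.IsNondegenerateTwoPoint S ∧
Literature.Probability.LatticeModels.IsMoebiusCovariant Δ S)`

## Assembly
Pure logic (sorry-free in Sketch.lean, theorem assembly_holds): take the witness (ρ, Δ, S) of
MoebiusLimit; GapForcesFarMerging applied to
EnergyGapPowerLaw gives far merging along dilations of a fixed shape; FarMergingGivesU4 applied to
it and to (ρ, S) (positivity of ρ, the
pointwise limit and non-degeneracy are parts of the MoebiusLimit witness) gives HasNontrivialU4 S;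
repack the six components into
Ising3DConformalLimit (= Literature.Probability.LatticeModels.CritIsing3DConformalLimit).

Rationale: WHY THIS LINE. Clause (iii) has one rigorous handle, U₄ = −2⟨σσ⟩⟨σσ⟩·P[two sourced currents merge]
(AizenmanCMP1982; AizenmanDuminilCopinAnnals2021 eq. (3.11), in tree
ursellFour_eq_doubleCurrent_holds), and every existing (iii)-line asks for a LOWER bound on merging
of FAR-apart strands at ONE scale, which forces a strict beyond-mean-field exponent input at the
spin level (η < 1/2 plus fatness in top-heavy-bubble-nontriviality; η > 0 in
AnomalousForcesInteraction; non-saturation in PerfectScreening). Averaging Aizenman's identity over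
the two pairings gives the exact line ⟨σ_aσ_b;σ_xσ_y⟩ = G_ax G_by·P^ax⊗P^by[a↮b] + G_ay
G_bx·P^ay⊗P^bx[a↮b] (DuminilCopin2016 §4; AizenmanDuminilCopinAnnals2021 (3.7)): the truncated
ENERGY correlation is a non-intersection probability of strands tied at NEIGHBOURING nails, and Δ_ε
− 2Δ_σ is a current non-intersection exponent (2D check: 3/2 from Δ_ε = 1, Δ_σ = 1/8; the 2-leg
watermelon reading of ε, Nienhuis 1984 / Duplantier–Saleur 1987; d ≥ 5: 0). Adjacent strands get a
fresh chance to touch at EVERY dyadic scale, so the route trades the strict single-scale exponent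
inequality for (a) an UPPER bound in the energy sector with margin 0.38 instead of 0.036 (GAP) and
(b) a cross-scale decoupling lemma for sourced currents (TRANSFER) in the style of the separation
lemmas of 3D loop-erased walk (Kozma arXiv:math/0508344; Shiraishi doi:10.1214/16-AOP1165) and of
Lawler's intersection-exponent calculus (Lawler1991) — the imported area is the multiscale theory of
non-intersection of random paths, with an explicit dictionary (Brownian/LERW path ↦ sourced current
cluster; non-intersection exponent ξ ↦ κ = 2(Δ_ε − 2Δ_σ); separation lemma ↦ AdjacentDecoupling).
The in-tree second-moment toolbox of AizenmanDuminilCopinAnnals2021 Lemma 4.4 / Prop. A.3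
(IntersectionSecondMoment.lean, proved) run at d = 3 in the adjacent geometry gives the first rung
(RungOneAdjacentMerging). Nothing here is in the negatives index (only SAW item 0772 is refuted);
the conclusion is 0636 verbatim with IsNondegenerateTwoPoint as hypothesis, so the junk refutations
of 0663/0666 and the coincident-locus refutations of 0632/0637 do not bite.

RANKED CRUXES. #0 Target (target) — X = EnergyGapPowerLaw ∧ GapForcesFarMerging ∧ FarMergingGivesU4
∧ MoebiusLimit (the four decls below, inlined). (why it might fail: inherits the open Δ_ε > 2Δ_σ
gap, the missing decoupling technology for sourced currents on ℤ³, and every open covariance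
question inside MoebiusLimit.) [AizenmanCMP1982, AizenmanDuminilCopinAnnals2021, DuminilCopin2016,
KosPolandSimmonsDuffinVichi2016, DuminilCopinICM2022]
#2 GapForcesFarMerging (crux) — (TRANSFER, card A4 in spin clothing) if ⟨σ₀σ_e₂;σ_xσ_x+e₂⟩_β_c ≤
C‖x‖^-κ⟨σ₀σ_x⟩² for some κ > 0 (adjacent avoidance decays as a power), then there are c > 0 and an
injective lattice quadruple x : Fin 4 → ℤ³ such that for infinitely many dilations L, U₄^latt(Lx) ≤
−c⟨σ_Lx₀σ_Lx₁⟩⟨σ_Lx₂σ_Lx₃⟩. Intended proof: EnergyFactorisation turns the hypothesis into A_R :=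
P^0x⊗P^e₂x'[0↮e₂] ≤ CR^-κ; a separation lemma (conditionally on avoidance up to scale r, the two
strands cross ∂B_r at mutual distance ≥ r/10 with probability ≥ c, as for Brownian paths and 3D
loop-erased walk) and a cross-scale decoupling lemma for pairs of sourced critical currents
(conditionally on the configuration in B_r, on avoidance so far and on r/10-separation, the
probability to merge in B_2r∖B_r is at most C·q_r, q_r = sup over fat dyadic source quadruples at
scale r of the double-current merging probability, uniformly over typical boundary flux) give A_R ≥
c·exp(−C Σ_(2^k≤R) (q_(2^k) + 1 − c))-type recursions, sharpened to A_R ≥ c·exp(−C Σ_(2^k≤R)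
q_(2^k)) once separated strands re-separate at the next scale with probability 1 − O(q), hence
q_(2^k) ≥ κ/2C on a positive density of scales; pigeonhole over the finite family of dyadic shapes
pins one shape along infinitely many scales, and U₄ = −2GG·P[merge]
(ursellFour_eq_doubleCurrent_holds, infinite-volume form) converts back to spins. [difficulty:
open-problem] (why it might fail: needs a SEPARATION lemma (given avoidance up to scale r the
strands exit B_r at distance ≍ r with prob ≥ c) plus boundary-flux decoupling for SOURCED currents
on ℤ³ — neither exists (ADC21 mixing: d=4, sourceless); and a Gaussian limit whose lattice energy
has no :σ²: part obeys GAP with U₄≡0.) [AizenmanDuminilCopinAnnals2021, AizenmanCMP1982, Lawler1991,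
doi:10.1214/16-AOP1165, arXiv:math/0508344, DuminilCopin2016]
#3 EnergyGapPowerLaw (crux) — (GAP, "ε is not σ²") there are κ > 0 and C with ⟨σ₀σ_e₂σ_xσ_x+e₂⟩_β_c
− ⟨σ₀σ_e₂⟩_β_c⟨σ_xσ_x+e₂⟩_β_c ≤ C‖x‖^-κ ⟨σ₀σ_x⟩²_β_c for all x ≠ 0 in ℤ³ (+ state at β_c(3) = the
unique critical state; e₂ = Pi.single 1 1; sup norm). Small x are absorbed in C since ⟨σ₀σ_x⟩_β_c ≥
c‖x‖⁻² > 0 (criticalTwoPoint_bounds_holds), so the content is the large-x power law; prediction κ =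
2(Δ_ε − 2Δ_σ) ≈ 0.753; in exponent language Δ_ε > 2Δ_σ, equivalently (under scaling) γ > 1 strictly
— the correlation-level sharpening of γ ≥ 1 (Aizenman/Glimm–Jaffe) and Fisher's (2−η)ν ≥ γ. Intended
proof: EnergyFactorisation + FATNESS-LITE (L²-averaged one-point density of a single sourced current
on infinitely many shells) + a decoupling-lite across a positive density of scales. [difficulty:
open-problem] (why it might fail: no 3D Ising exponent is rigorously off its mean-field edge; single
sourced currents may be polynomially thinner than duplicated clusters at most scales, so merging may
not be harvestable scale by scale without the sourceless partner (then only a 3β-superposed identity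
remains).) [KosPolandSimmonsDuffinVichi2016, PolandRychkovVichi2019, DuminilCopin2016,
DuminilCopinPanis2025LowerBounds, FernandezFrohlichSokal1992, doi:10.1103/PhysRev.180.594,
doi:10.1051/jp1:1997204]
#4 MoebiusLimit (crux) — (ML, IMPORTED COMPLEMENT = item stmt-CriticalPhenomena-1344 verbatim) the
critical Ising correlators on ℤ³ have a non-degenerate pointwise scaling limit (ρ > 0 on (0,1], Δ >
0, S) that is Möbius covariant with dimension Δ — the conjunct minus clause (iii). This route does
not attack existence, rotations or inversion; it bets on IsingEuclidUpgrade r5/r6, IsingCFTData r2,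
HyperoctahedralRP and the covariance cards. [difficulty: open-problem] (why it might fail: existence
of the full pointwise limit, rotation invariance and inversion covariance are each open on ℤ³
(ICM2022 §8.1, §8.4); ScaleCovarianceNotMoebius shows Euclidean+scale data alone never force
inversion.) [DuminilCopinICM2022, PolandRychkovVichi2019,
Literature.Barriers.CriticalPhenomena.ScaleCovarianceNotMoebius,
Literature.Probability.LatticeModels.CritIsing3DEuclideanLimit]
#5 RungOneAdjacentMerging (crux) — (RUNG 1 of the card, the duplicated system; off the assembly
chain by design — it is the calibration of the whole line and a kill criterion) in the free-boundary
box Λ_n of ℤ³ at β_c(3) (the nearest-neighbour graph of ℤ³ induced on box 3 n, in Lean `(zdGraph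
3).comap Subtype.val` on ↥(box 3 n) — rev-2 restatement; rev 1 used freeBoxGraph 3 n, which differs
only by the isolated outer layer box 3 (n+1) ∖ box 3 n, immaterial since n → ∞ first), let (n₁,n₃) ~
P^(0x,∅) and (n₂,n₄) ~ P^(e₂ x+e₂,∅) be independent pairs of currents (doubleCurrentMeasure); then
the probability that the clusters C_(n₁+n₃)(0) and C_(n₂+n₄)(e₂) are DISJOINT (in Lean: no vertex u
with 0 ↔ u in n₁+n₃ and e₂ ↔ u in n₂+n₄, written with tracedConn — the same event as cluster
disjointness, ext/simp one-liner, SketchEquiv.lean in the route evidence) tends to 0 as ‖x‖ → ∞ (n →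
∞ first): duplicated strands tied at neighbouring nails always end up touching. First moments are
exact (P^(0x,∅)[u ∈ C(0)] = ⟨σ₀σ_u⟩⟨σ_uσ_x⟩/⟨σ₀σ_x⟩, in tree
tsum_epairWeight_mul_indicator_mem_cluster), second moments by Prop. A.3
(ecurrentSum_empty_mul_tsum_connInd_mul_connInd_le), and Σ_shell G² per dyadic shell is unbounded
because B(β_c) = ∞ on ℤ³ (DuminilCopinPanis2025LowerBounds Thm 1.8). [difficulty: L] (why it might
fail: single-shell Paley–Zygmund gives only P[merge in shell k] ≥ c; pushing avoidance to 0 over K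
shells needs cross-shell decorrelation E[N_jN_k] ≤ (1+o(1))EN_jEN_k, i.e. asymptotic ratio
regularity G(v−u)/G(v)→1 or an ADC-type mixing theorem — neither is known on ℤ³.)
[AizenmanDuminilCopinAnnals2021, DuminilCopinPanis2025LowerBounds, MessagerMiracleSoleJSP1977,
Literature.Probability.LatticeModels.Current.tsum_prodWeight_mul_interCount,
Literature.Probability.LatticeModels.Current.sq_mul_tsum_prodWeight_mul_interCount_sq_le]
#9 FarMergingGivesU4 (support) — (GLUE, provable now) far merging along infinitely many dilations of
a fixed injective lattice shape x forces item 0636: for every ρ > 0 on (0,1] and S with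
HasPointwiseScalingLimit (criticalCorr 3) ρ S and IsNondegenerateTwoPoint S, HasNontrivialU4 S.
Proof: take the continuum configuration y = x (cast to ℝ³) and meshes δ_j = 1/L_j along the
dilations; latticeApprox δ_j y = L_j x exactly, so ρ(δ_j)⁴U₄^latt(L_jx) → limitConnectedFour S y and
ρ(δ_j)²⟨σσ⟩ → S 2 at the two pairs (pointwise convergence at the non-coincident y, no continuity of
S needed); the lattice inequality gives limitConnectedFour S y ≤ −c S₂(y₀,y₁)S₂(y₂,y₃) < 0.
[difficulty: provable-now] [Literature.Probability.LatticeModels.HasPointwiseScalingLimit,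
Literature.Probability.LatticeModels.HasNontrivialU4, AizenmanCMP1982]
#9 EnergyFactorisation (support) — (card A1, the exact line; provable now from
ursellFour_eq_doubleCurrent_holds applied to the two pairings (a,x|b,y) and (a,y|b,x), symmetry of
connectedFour, and isProbabilityMeasure_doubleCurrentMeasure_holds where the two-point prefactor is
non-zero) for the n.n. Ising model with free boundary condition and zero field on any finite graph,
β ≥ 0 and vertices a b x y: ⟨σ_aσ_bσ_xσ_y⟩ − ⟨σ_aσ_b⟩⟨σ_xσ_y⟩ = ⟨σ_aσ_x⟩⟨σ_bσ_y⟩·P^ax⊗P^by[a ↮ b in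
n₁+n₂] + ⟨σ_aσ_y⟩⟨σ_bσ_x⟩·P^ay⊗P^bx[a ↮ b in n₁+n₂]. With (a,b) = (0,e₂) a bond and (x,y) = (x,x+e₂)
this is ⟨ε₀;ε_x⟩ = G²·A^par + G'²·A^cross. [difficulty: provable-now]
[Literature.Probability.LatticeModels.ursellFour_eq_doubleCurrent_holds,
Literature.Probability.LatticeModels.isingCorr_mul_eq_doubleCurrent_subcurrent_holds,
AizenmanCMP1982, DuminilCopin2016]
#9 EnergyGapSoft (support) — (soft gap, the first milestone of EnergyGapPowerLaw: "ε ≠ :σ²: on ℤ³")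
⟨σ₀σ_e₂;σ_xσ_x+e₂⟩_β_c = o(⟨σ₀σ_x⟩²_β_c) as ‖x‖ → ∞. Intended proof: EnergyFactorisation +
FATNESS-LITE on infinitely many shells (Σ_(u∈S_k) P^0x[u ∈ C_n₁(0)]² ≥ cΣ_(u∈S_k)G(u)²) + the
RungOne second moment; strictly weaker than GAP, not used by the assembly. [difficulty: L]
[AizenmanDuminilCopinAnnals2021, DuminilCopinPanis2025LowerBounds, DuminilCopin2016]

TWO-LAYER PLAN. Foreseen glued splits (nothing filed now; both wait for the definition request
SourcedDoubleCurrentZ3 — infinite-volume sourced currents on ℤ³ with a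
cluster API): GapForcesFarMerging ⇐ AdjacentSeparation → AdjacentDecoupling → GapForcesFarMerging
(glue = dyadic-shape pigeonhole plus the infinite-volume
form of U₄ = −2GG·P[merge], support-sized), where AdjacentSeparation (crux: conditioned on avoidance
up to scale r, the two sourced clusters cross
∂B_r at mutual distance ≥ r/10 with probability ≥ c — the analogue of Lawler's Brownian and
Kozma–Shiraishi's LERW separation lemmas) and
AdjacentDecoupling (crux: for r/10-separated strands the conditional merging probability in B_2r∖B_r
given the inside configuration is ≤ C·q_r
and ≥ c·p_r, uniformly over boundary flux with a tight number of macroscopic crossings) carry the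
content. EnergyGapPowerLaw ⇐ FatnessLite → DecouplingLite → EnergyGapPowerLaw, where FatnessLite
(crux: Σ_(u∈S_k)P^0x[u∈C_n₁(0)]² ≥
cΣ_(u∈S_k)G(u)² on a positive density of dyadic shells, uniformly in ‖x‖ ≥ 2^(k+2)) and
DecouplingLite (the upper-bound half of AdjacentDecoupling).
RungOneAdjacentMerging is not split (one computation); if its cross-shell decorrelation stalls, the
child would be a two-point ratio-regularity
statement shared with card every-scale-regular-multiplicative-fekete. MoebiusLimit is owned by the
covariance routes (HyperoctahedralRP items
1980–1982, IsingEuclidUpgrade 0637/0638) and is never split here.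

KILL CRITERIA. Refutation of EnergyGapPowerLaw (a proof that ⟨ε₀;ε_x⟩/⟨σ₀σ_x⟩² decays slower than
every power — e.g. stays ≥ c along a sequence, Δ_ε = 2Δ_σ on ℤ³) closes the route outright
(close --reason refuted:EnergyGapPowerLaw) and is itself major news (mean-field energy sector).
Refutation of RungOneAdjacentMerging (duplicated
adjacent clusters avoid with probability ≥ c at all distances) kills the mechanism "adjacent strands
touch at every scale" and closes the route
(refuted:RungOneAdjacentMerging) even though the assembly does not use it. Refutation of
GapForcesFarMerging as a statement can only come with
¬FarMerging, i.e. with a Gaussian-type scenario for U₄ — then 0636 is false for some limit and every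
(iii)-route dies with the conjunct. Refutation
of MoebiusLimit refutes Ising3DConformalLimit itself. Item 0636 proved elsewhere
(AnomalousForcesInteraction, PerfectScreening, top-heavy line)
moots GAP+TRANSFER for the summit; the route is then superseded, while EnergyGapPowerLaw and RungOne
keep independent interest ("ε ≠ σ² on ℤ³").

NOT DECOMPOSED YET. The separation and decoupling lemmas themselves and the tightness of macroscopic
boundary crossings of a sourced cluster (children of
GapForcesFarMerging, untypeable until SourcedDoubleCurrentZ3 lands); FATNESS-LITE (child of
EnergyGapPowerLaw); the converse direction "uniform far merging ⇒ κ > 0" (card A6: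
any proof of 0636 by another route then yields the strict OPE gap Δ_ε > 2Δ_σ — recorded, not filed);
the exponent bookkeeping γ > 1 ⇔ Δ_ε > 2Δ_σ
(thermodynamic face, owned by card gamma-strict-thermal-face-nontriviality); infinite-volume
versions of EnergyFactorisation; any work on
MoebiusLimit.

CHEAPEST FALSIFIER. (a) The 2D unit test of the identity and of the exponent dictionary: on ℤ² at
β_c the exact asymptotics ⟨ε₀;ε_x⟩ ~ c/|x|² (Hecht 1967 /
McCoy–Wu) and ⟨σ₀σ_x⟩² ~ c'/|x|^(1/2) give A_x ~ |x|^(-3/2): a worm-algorithm (Prokof'ev–Svistunov)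
sample of two independent sourced currents
with adjacent parallel sources must reproduce slope 3/2 on ℤ² and ≈ 0.75 on ℤ³ (kit job not run: the
hub is compute-free this session and the
check calibrates rather than kills). (b) The cheapest KILL is on paper: run the RungOne second
moment with only the PROVED inputs (IR bound
G ≤ C/‖x‖, lower bound G ≥ c/‖x‖², MMS monotonicity) and check whether Var N = o((EN)²) can hold
without ratio regularity — if a refuter shows the
multi-shell variance is provably not controllable by bubble divergence alone (e.g. a toy two-point
function obeying all proved bounds with
E[N_jN_k] ≥ (1+c)EN_jEN_k), RungOne's advertised proof dies and the line is down to the decoupling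
bet. (c) Lookup: is "Δ_ε > 2Δ_σ ⇔ positive
non-intersection exponent of adjacent sourced currents" already in print (Nienhuis/Duplantier–Saleur
watermelon literature is 2D and loop-model;
nothing found for currents on ℤ³)?

NUMBERS. Δ_σ = 0.5181489(10), Δ_ε = 1.412625(10), η = 0.0362978(20) (conformal bootstrap,
KosPolandSimmonsDuffinVichi2016; PolandRychkovVichi2019 Table II);
predicted κ = 2(Δ_ε − 2Δ_σ) = 0.75265(1) on ℤ³; κ = 3/2 exactly on ℤ² (Δ_ε = 1, Δ_σ = 1/8); κ = 0
for d ≥ 5 (ε = :σ²:, bubble finite) and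
logarithmic at d = 4. Margins of the competing strict inequalities: η ≈ 0.036
(AnomalousForcesInteraction), 3/4 − Δ_σ ≈ 0.23 (intersection
threshold), Δ_ε − 2Δ_σ ≈ 0.376 (this route), γ − 1 ≈ 0.237. Rigorous on ℤ³: c‖x‖⁻² ≤ ⟨σ₀σ_x⟩_β_c ≤
C‖x‖⁻¹ (criticalTwoPoint_bounds_holds);
B(β_c) = ∞ (DuminilCopinPanis2025LowerBounds Thm 1.8, in tree only inside the named fact
Literature.Barriers.CriticalPhenomena.LaceExpansionIsingAboveFourNarrow);
η ≤ 1/2 if it exists (DuminilcopinPanis2025 Thm 1.5); U₄ ≤ 0 (Lebowitz) and the tree bound. Numerics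
of ⟨ε;ε⟩ on the cubic lattice:
doi:10.1051/jp1:1997204. Items at open: 9.

DEFINITION REQUESTS. (1) notion SourcedDoubleCurrentZ3 (--topic
Literature/Probability/LatticeModels, --for GapForcesFarMerging): the infinite-volume law P^A_β_c on
ℤ³
of a current with finite source set A (and products P^A ⊗ P^B, P^(A,∅)), as the weak limit of
doubleCurrentMeasure on freeBoxGraph 3 n
(AizenmanDuminilCopinAnnals2021 §3, display before (3.10); Panis2023Triviality Def. 4.1–4.3), with
the cluster C_(n₁+n₂)(v) of a vertex and the
flux of a cluster through ∂B_r — the vocabulary of AdjacentDecoupling / FatnessLite (layer 2). The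
tree has finite graphs (RandomCurrents,
WeightedCurrents, IntersectionSecondMoment) and the SOURCELESS ADS limit only
(DoubleCurrentsInfinite). (2) cite fact wanted: "B(β_c(3)) = ∞"
as a standalone Literature fact NNIsing.bubbleDiagram 3 (criticalBeta 3) = ∞
(DuminilCopinPanis2025LowerBounds Thm 1.8), today available only
as a conjunct of the named fact LaceExpansionIsingAboveFourNarrow; RungOneAdjacentMerging's proof
consumes it as a hypothesis until then. (3) IMPORT DISCIPLINE (route-repair rev 2, 2026-08-15):
beyond the sub-problem Statement the route file imports only
Literature.Probability.LatticeModels.RandomCurrents (doubleCurrentMeasure, tracedConn, Current; all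
11 of its named facts have unconditional `_holds` in RandomCurrentsProofs). UrsellFourCurrents /
DoubleCurrents / WeightedCurrents were dropped: no item needs them once RungOneAdjacentMerging is
phrased over the induced box graph and tracedConn, and their import closure (GKSInequalities,
MagnetizationContinuity, GriffithsMonotonicity, IsingMonotonicity, CurrentSwitching,
ModifiedSimonInequality, Sharpness(+Proofs), CorrelationInequalities, GibbsSpecification,
GibbsStates — 19 modules beyond the Statement's own closure) carried the unproved XL named facts
Literature.Probability.LatticeModels.aizenman_higuchi and bodineau_translationInvariant into the
route's import cone although no thesis mentions them. Provers' Theorems files import what their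
PROOFS need (WeightedCurrents' Current.cluster and tsum_epairWeight_mul_indicator_mem_cluster,
IntersectionSecondMoment, UrsellFourCurrents' ursellFour_eq_doubleCurrent_holds, DoubleCurrents'
freeBoxGraph): the bridges `{pq | ∀ u, ¬(pq.1 ∈ tracedConn G o u ∧ pq.2 ∈ tracedConn G a u)} = {pq |
Disjoint (cluster (pq.1.1+pq.1.2) o) (cluster (pq.2.1+pq.2.2) a)}` (ext + simp [mem_tracedConn_iff,
mem_cluster_iff, Finset.disjoint_left]) and `((zdGraph 3).comap Subtype.val).Adj p q ↔ (zdGraph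
3).Adj p.1 q.1` (Iff.rfl) are one-liners. needs-fact: none of the reported cone facts is used by any
item.

Novelty: Searches (2026-08-15): `lit search --source crossref "energy energy correlations Ising random
current"` (15 rows; relevant: doi:10.1051/jp1:1997204
Netz–Gersonde 1997 cubic-lattice numerics of ⟨ε;ε⟩, doi:10.1214/23-aap1968 Izyurov–Kemppainen–Tuisku
2D torus energy correlations, doi:10.1063/1.4745910
GGM 2012 planar non-integrable energy correlations — none with currents or d = 3 exponents); `lit
search --hybrid --source local "energy density
correlations random current representation switching lemma sources"` (10 docs; only Friedli–Velenik
p. 161, random-current basics); `lit galaxy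
search "random current representation energy operator" --star all` (0 rows) and `"watermelon
exponent" --star pdf` (5 rows: Jacobsen, CFT applied
to loop models ch. 14; Vernier–Jacobsen–Salas arXiv:1509.02804 — the 2D watermelon/2-leg-operator
literature); `lit frontier CriticalPhenomena
--since 2021` (30 rows, planar SLE/CLE and lace expansion; one 3D Ising item arXiv:2604.05772
"Percolation in the three-dimensional Ising model",
FK/geometric clusters, not currents); `lit bridges CriticalPhenomena --cross any` (30 rows: surveys
and lecture notes, arXiv:1707.00520, arXiv:1708.00058; one d ≥ 3 geometric item arXiv:2406.15243,
the FK-Ising incipient infinite cluster — FK clusters, not sourced currents); openalex/arxiv 429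
this session; `lit read arXiv:2404.05700` (Thm 1.8 bubble divergence, Remark 1.9); plus the
card's own searches and the refuter novelty audit (Aizenman 1982 pairing-independence, S  [refs: 10.1051/jp1:1997204, 10.1214/23-aap1968, 10.1063/1.4745910, 10.1214/16-AOP1165, 1509.02804, 2604.05772, 1707.00520, 1708.00058, 2406.15243, 2404.05700, math/0508344, doi:10.1051/jp1, doi:10.1214/23-aap1968, doi:10.1063/1.4745910, doi:10.1214/16-AOP1165, AizenmanCMP1982, DuminilCopin2016, AizenmanDuminilCopinAnnals2021, Lawler1991]

Barriers (technique_class: random-currents-adjacent-avoidance, multiscale): - technique_class: random-currents-adjacent-avoidance, multiscale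
- Literature.Barriers.CriticalPhenomena.IsingTrivialityFromDimensionFour: evaded — nothing is
dimension-uniform: EnergyGapPowerLaw is FALSE for d ≥ 5 (ε = :σ²:, κ = 0, adjacent strands avoid
with positive probability because the bubble converges) and RungOne's input B(β_c) = ∞ holds exactly
for d ≤ 4 (logarithmic, marginal, at d = 4, where the same count reproduces ADC21's 1/log per
scale); the dimension-blind steps (switching identities, EnergyFactorisation, the glue) are
legitimately uniform.
- Literature.Barriers.CriticalPhenomena.LongRangeTrivialityOnZ3: evaded — for the
reflection-positive algebraic couplings with α < 3/2 the bubble converges (G ~ ‖x‖^-(3−α), 2(3−α) >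
3) and Δ_ε = 2Δ_σ = 3 − α: EnergyGapPowerLaw fails there, correctly on Panis's Gaussian side; the
line is interaction-specific through bubble divergence at the source scale and through κ > 0, so
InteractionUniformZ3 fails at GAP.
- Literature.Barriers.CriticalPhenomena.TransverseCrossingsNeedNotMeet: met in spirit ("in d = 3 two
strands crossing the same annulus need not meet") and evaded the way the slab gluing lemma evades it
— merging is never inferred from topology but from a PROBABILISTIC second moment fed by exact
one-point densities (source insertion) and, in layer 2, by decoupling; the bet is that adjacent
sources make Σ_scales P[merge at scale k] diverge.
- Literature.Barriers.CriticalPhenomena.LaceExpansionIsingAboveFour: not met (n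

Novelty grade: new-combination — refuter gen-2 (rreview 10c13a27-g2, 2026-08-15): new-combination = (A) exact random-current line for the truncated energy correlation (Aizenman82 switching; DC16 (24); ADC21 (3.7)/(3.11); EnergyFactorisation 4472 is their two-pairing average, KNOWN, in tree as components) x (B) multiscale non-inters (refuter refuter-rreview-route-CriticalPhenomena--10c13a27-g2-0, 2026-08-15T14:48:08Z; prior: AizenmanCMP1982 secs 4-5 (switching lemma, U4 as double-current intersection; tree bound = kappa=0 of GAP with Lebowitz/GKS), DuminilCopin2016 lecture notes eq. (24); AizenmanDuminilCopinAnnals2021 eqs (3.7),(3.11), Lemma 4.4, Prop. A.3 (second-moment toolbox, d=4, far sources; in tree IntersectionSecondMoment.lean), Sokal 1981 / Aizenman-Fernandez bubble bound on specific heat (energy sector mean)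

History (route lifecycle, newest last):
- 2026-08-15T16:55:06Z · rev 2: restated RungOneAdjacentMerging (stmt-CriticalPhenomena-4470) — route-repair gen2 (cone): imports 3→1 — drop Literature.Probability.LatticeModels.{UrsellFourCurrents,DoubleCurrents,WeightedCurrents}, keep only …RandomCurrent (planner-rrepair-CriticalPhenomena-EnergyNotSig-7ca3a36f-g2-0)
- 2026-08-16T03:14:00Z · rev 4: dropped stmt-CriticalPhenomena-14161 — route-repair (badge, unit rbadge-CriticalPhenomena-EnergyNotSigm-7ca3a36f): fixes needs_repair `route.target-unreachable`. (1) adds the support glue item Cruxes (planner-rbadge-CriticalPhenomena-EnergyNotSigm-7ca3a36f-0)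
- 2026-08-24T22:44:53Z · DORMANT — reconciler: no traction for 7.1 d (last activity item-evidence-added at 2026-08-17T18:53:45Z); parked, not closed — `ledger route dormant route-CriticalPhenomen (operator:999:1597487)
- 2026-08-27T19:26:50Z · REACTIVATED — reconciler: reactivated — activity statement-checked at 2026-08-27T17:30:33Z after parking at 2026-08-24T22:44:53Z (operator:999:2819820)
- 2026-09-03T10:19:17Z · DORMANT — reconciler: no traction for 5 d (last activity statement-checked at 2026-08-29T09:16:15Z); parked, not closed — `ledger route dormant route-CriticalPhenomena-En (operator:999:375589)

sub-problem: Ising3DConformalLimit · status: dormant · opened planner-plancard-CriticalPhenomena-Ising3DCon-838b66d9-0 2026-08-15T11:34:19Z · rev 5 · ledger route-CriticalPhenomena-EnergyNotSigmaSquared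
GENERATED by the gate from the ledger (D-0016/17). Provers cite these decls: `theorem foo : Summit.CriticalPhenomena.Ising3DConformalLimit.Theses.EnergyNotSigmaSquared.<Decl> := …` in Summits/CriticalPhenomena/Ising3DConformalLimit/Theorems/<Name>.lean.
-/

namespace Summit.CriticalPhenomena.Ising3DConformalLimit.Theses.EnergyNotSigmaSquared

open scoped BigOperators Topology Manifold Classical MeasureTheory ProbabilityTheory Matrix InnerProductSpace ComplexConjugate ContinuousMap
open Filter Set Function TopologicalSpace MeasureTheory

attribute [summit_statement] _root_.Ising3DConformalLimit

/-- item stmt-CriticalPhenomena-4467 · target · rank 0 · open · by planner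
why it might fail: Conjunction GAP ∧ TRANSFER ∧ GLUE ∧ ML: inherits the open strict gap Δ_ε>2Δ_σ on ℤ³, the missing separation/decoupling technology for sourced currents on ℤ³, and every open covariance question (existence, rotations, inversion) inside MoebiusLimit.
sources: AizenmanCMP1982, AizenmanDuminilCopinAnnals2021, DuminilCopin2016, KosPolandSimmonsDuffinVichi2016, DuminilCopinICM2022
[target] X = EnergyGapPowerLaw ∧ GapForcesFarMerging ∧ FarMergingGivesU4 ∧ MoebiusLimit (the four
decls below, inlined). -/
@[route_item "route-CriticalPhenomena-EnergyNotSigmaSquared"]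
def Target : Prop :=
  (∃ κ C : ℝ, 0 < κ ∧ ∀ x : Literature.Probability.LatticeModels.Site 3, x ≠ 0 → Literature.Probability.LatticeModels.criticalCorr 3 4 ![0, (Pi.single 1 1 : Literature.Probability.LatticeModels.Site 3), x, x + Pi.single 1 1] - Literature.Probability.LatticeModels.criticalCorr 3 2 ![0, (Pi.single 1 1 : Literature.Probability.LatticeModels.Site 3)] * Literature.Probability.LatticeModels.criticalCorr 3 2 ![x, x + Pi.single 1 1] ≤ C * (‖x‖ : ℝ) ^ (-κ) * Literature.Probability.LatticeModels.criticalTwoPoint 3 x ^ 2) ∧ ((∃ κ C : ℝ, 0 < κ ∧ ∀ x : Literature.Probability.LatticeModels.Site 3, x ≠ 0 → Literature.Probability.LatticeModels.criticalCorr 3 4 ![0, (Pi.single 1 1 : Literature.Probability.LatticeModels.Site 3), x, x + Pi.single 1 1] - Literature.Probability.LatticeModels.criticalCorr 3 2 ![0, (Pi.single 1 1 : Literature.Probability.LatticeModels.Site 3)] * Literature.Probability.LatticeModels.criticalCorr 3 2 ![x, x + Pi.single 1 1] ≤ C * (‖x‖ : ℝ) ^ (-κ) * Literature.Probability.LatticeModels.criticalTwoPoint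 3 x ^ 2) → (∃ c : ℝ, 0 < c ∧ ∃ x : Fin 4 → Literature.Probability.LatticeModels.Site 3, Function.Injective x ∧ ∀ L₀ : ℕ, ∃ L : ℕ, L₀ ≤ L ∧ Literature.Probability.LatticeModels.criticalCorr 3 4 (fun i => (L : ℤ) • x i) - (Literature.Probability.LatticeModels.criticalCorr 3 2 ![(L : ℤ) • x 0, (L : ℤ) • x 1] * Literature.Probability.LatticeModels.criticalCorr 3 2 ![(L : ℤ) • x 2, (L : ℤ) • x 3] + Literature.Probability.LatticeModels.criticalCorr 3 2 ![(L : ℤ) • x 0, (L : ℤ) • x 2] * Literature.Probability.LatticeModels.criticalCorr 3 2 ![(L : ℤ) • x 1, (L : ℤ) • x 3] + Literature.Probability.LatticeModels.criticalCorr 3 2 ![(L : ℤ) • x 0, (L : ℤ) • x 3] * Literature.Probability.LatticeModels.criticalCorr 3 2 ![(L : ℤ) • x 1, (L : ℤ) • x 2]) ≤ -(c * (Literature.Probability.LatticeModels.criticalCorr 3 2 ![(L : ℤ) • x 0, (L : ℤ) • x 1] * Literature.Probability.LatticeModels.criticalCorr 3 2 ![(L : ℤ) • x 2, (L : ℤ)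 • x 3])))) ∧ ((∃ c : ℝ, 0 < c ∧ ∃ x : Fin 4 → Literature.Probability.LatticeModels.Site 3, Function.Injective x ∧ ∀ L₀ : ℕ, ∃ L : ℕ, L₀ ≤ L ∧ Literature.Probability.LatticeModels.criticalCorr 3 4 (fun i => (L : ℤ) • x i) - (Literature.Probability.LatticeModels.criticalCorr 3 2 ![(L : ℤ) • x 0, (L : ℤ) • x 1] * Literature.Probability.LatticeModels.criticalCorr 3 2 ![(L : ℤ) • x 2, (L : ℤ) • x 3] + Literature.Probability.LatticeModels.criticalCorr 3 2 ![(L : ℤ) • x 0, (L : ℤ) • x 2] * Literature.Probability.LatticeModels.criticalCorr 3 2 ![(L : ℤ) • x 1, (L : ℤ) • x 3] + Literature.Probability.LatticeModels.criticalCorr 3 2 ![(L : ℤ) • x 0, (L : ℤ) • x 3] * Literature.Probability.LatticeModels.criticalCorr 3 2 ![(L : ℤ) • x 1, (L : ℤ) • x 2]) ≤ -(c * (Literature.Probability.LatticeModels.criticalCorr 3 2 ![(L : ℤ) • x 0, (L : ℤ) • x 1] * Literature.Probability.LatticeModels.criticalCorr 3 2 ![(L : ℤ) • x 2, (L : ℤ)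 • x 3]))) → ∀ (ρ : ℝ → ℝ) (S : Literature.Probability.LatticeModels.CorrFamily 3), (∀ δ ∈ Set.Ioc (0:ℝ) 1, 0 < ρ δ) → Literature.Probability.LatticeModels.HasPointwiseScalingLimit (Literature.Probability.LatticeModels.criticalCorr 3) ρ S → Literature.Probability.LatticeModels.IsNondegenerateTwoPoint S → Literature.Probability.LatticeModels.HasNontrivialU4 S) ∧ (∃ (ρ : ℝ → ℝ) (Δ : ℝ) (S : Literature.Probability.LatticeModels.CorrFamily 3), (∀ δ ∈ Set.Ioc (0:ℝ) 1, 0 < ρ δ) ∧ 0 < Δ ∧ Literature.Probability.LatticeModels.HasPointwiseScalingLimit (Literature.Probability.LatticeModels.criticalCorr 3) ρ S ∧ Literature.Probability.LatticeModels.IsNondegenerateTwoPoint S ∧ Literature.Probability.LatticeModels.IsMoebiusCovariant Δ S)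

/-- item stmt-CriticalPhenomena-4468 · crux · rank 2 · open · by planner
why it might fail: Implication GAP→far-merging: fails iff GAP holds while P[far merge]→0 on every shape (a generalized-free limit whose lattice energy has no :σ²: part obeys GAP with U₄≡0); the intended proof needs separation + boundary-flux decoupling for SOURCED currents on ℤ³, known only sourceless at d=4 (ADC21).
sources: AizenmanDuminilCopinAnnals2021, AizenmanCMP1982, Lawler1991, doi:10.1214/16-AOP1165, arXiv:math/0508344, DuminilCopin2016
[crux] (TRANSFER, card A4 in spin clothing) if ⟨σ₀σ_e₂;σ_xσ_x+e₂⟩_β_c ≤ C‖x‖^-κ⟨σ₀σ_x⟩² for some κ >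
0 (adjacent avoidance decays as a power), then there are c > 0 and an injective lattice quadruple x
: Fin 4 → ℤ³ such that for infinitely many dilations L, U₄^latt(Lx) ≤ −c⟨σ_Lx₀σ_Lx₁⟩⟨σ_Lx₂σ_Lx₃⟩.
Intended proof: EnergyFactorisation turns the hypothesis into A_R := P^0x⊗P^e₂x'[0↮e₂] ≤ CR^-κ; a
separation lemma (conditionally on avoidance up to scale r, the two strands cross ∂B_r at mutual
distance ≥ r/10 with probability ≥ c, as for Brownian paths and 3D loop-erased walk) and a
cross-scale decoupling lemma for pairs of sourced critical currents (conditionally on the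
configuration in B_r, on avoidance so far and on r/10-separation, the probability to merge in
B_2r∖B_r is at most C·q_r, q_r = sup over fat dyadic source quadruples at scale r of the
double-current merging probability, uniformly over typical boundary flux) give A_R ≥ c·exp(−C
Σ_(2^k≤R) (q_(2^k) + 1 − c))-type recursions, sharpened to A_R ≥ c·exp(−C Σ_(2^k≤R) q_(2^k)) once
separated strands re-separate at the next scale with probability 1 − O(q), hence q_(2^k) ≥ κ/2C on a
positive density of scales; pigeonhole over the f -/
@[route_item "route-CriticalPhenomena-EnergyNotSigmaSquared"]
def GapForcesFarMerging : Prop :=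
  (∃ κ C : ℝ, 0 < κ ∧ ∀ x : Literature.Probability.LatticeModels.Site 3, x ≠ 0 → Literature.Probability.LatticeModels.criticalCorr 3 4 ![0, (Pi.single 1 1 : Literature.Probability.LatticeModels.Site 3), x, x + Pi.single 1 1] - Literature.Probability.LatticeModels.criticalCorr 3 2 ![0, (Pi.single 1 1 : Literature.Probability.LatticeModels.Site 3)] * Literature.Probability.LatticeModels.criticalCorr 3 2 ![x, x + Pi.single 1 1] ≤ C * (‖x‖ : ℝ) ^ (-κ) * Literature.Probability.LatticeModels.criticalTwoPoint 3 x ^ 2) → (∃ c : ℝ, 0 < c ∧ ∃ x : Fin 4 → Literature.Probability.LatticeModels.Site 3, Function.Injective x ∧ ∀ L₀ : ℕ, ∃ L : ℕ, L₀ ≤ L ∧ Literature.Probability.LatticeModels.criticalCorr 3 4 (fun i => (L : ℤ) • x i) - (Literature.Probability.LatticeModels.criticalCorr 3 2 ![(L : ℤ) • x 0, (L : ℤ) • x 1] * Literature.Probability.LatticeModels.criticalCorr 3 2 ![(L : ℤ) • x 2, (L : ℤ) • x 3] + Literature.Probability.LatticeModels.criticalCorr 3 2 ![(L : ℤ) •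 x 0, (L : ℤ) • x 2] * Literature.Probability.LatticeModels.criticalCorr 3 2 ![(L : ℤ) • x 1, (L : ℤ) • x 3] + Literature.Probability.LatticeModels.criticalCorr 3 2 ![(L : ℤ) • x 0, (L : ℤ) • x 3] * Literature.Probability.LatticeModels.criticalCorr 3 2 ![(L : ℤ) • x 1, (L : ℤ) • x 2]) ≤ -(c * (Literature.Probability.LatticeModels.criticalCorr 3 2 ![(L : ℤ) • x 0, (L : ℤ) • x 1] * Literature.Probability.LatticeModels.criticalCorr 3 2 ![(L : ℤ) • x 2, (L : ℤ) • x 3])))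

/-- item stmt-CriticalPhenomena-4469 · crux · rank 3 · open · by planner
why it might fail: Asserts κ>0, i.e. Δ_ε>2Δ_σ (γ>1 strictly) at correlation level on ℤ³, where no Ising exponent is rigorously off its mean-field value; FALSE verbatim for d≥5 and RP long-range α<3/2 (finite bubble, ε=:σ²:), so a proof must harvest B(β_c)=∞ scale by scale for single sourced currents; none exists yet.
sources: KosPolandSimmonsDuffinVichi2016, PolandRychkovVichi2019, DuminilCopin2016, DuminilCopinPanis2025LowerBounds, FernandezFrohlichSokal1992, AizenmanCMP1982
[crux] (GAP, "ε is not σ²") there are κ > 0 and C with ⟨σ₀σ_e₂σ_xσ_x+e₂⟩_β_c −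
⟨σ₀σ_e₂⟩_β_c⟨σ_xσ_x+e₂⟩_β_c ≤ C‖x‖^-κ ⟨σ₀σ_x⟩²_β_c for all x ≠ 0 in ℤ³ (+ state at β_c(3) = the
unique critical state; e₂ = Pi.single 1 1; sup norm). Small x are absorbed in C since ⟨σ₀σ_x⟩_β_c ≥
c‖x‖⁻² > 0 (criticalTwoPoint_bounds_holds), so the content is the large-x power law; prediction κ =
2(Δ_ε − 2Δ_σ) ≈ 0.753; in exponent language Δ_ε > 2Δ_σ, equivalently (under scaling) γ > 1 strictly
— the correlation-level sharpening of γ ≥ 1 (Aizenman/Glimm–Jaffe) and Fisher's (2−η)ν ≥ γ. Intended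
proof: EnergyFactorisation + FATNESS-LITE (L²-averaged one-point density of a single sourced current
on infinitely many shells) + a decoupling-lite across a positive density of scales. [difficulty:
open-problem] -/
@[route_item "route-CriticalPhenomena-EnergyNotSigmaSquared"]
def EnergyGapPowerLaw : Prop :=
  ∃ κ C : ℝ, 0 < κ ∧ ∀ x : Literature.Probability.LatticeModels.Site 3, x ≠ 0 → Literature.Probability.LatticeModels.criticalCorr 3 4 ![0, (Pi.single 1 1 : Literature.Probability.LatticeModels.Site 3), x, x + Pi.single 1 1] - Literature.Probability.LatticeModels.criticalCorr 3 2 ![0, (Pi.single 1 1 : Literature.Probability.LatticeModels.Site 3)] * Literature.Probability.LatticeModels.criticalCorr 3 2 ![x, x + Pi.single 1 1] ≤ C * (‖x‖ : ℝ) ^ (-κ) * Literature.Probability.LatticeModels.criticalTwoPoint 3 x ^ 2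

/-- item stmt-CriticalPhenomena-1344 · crux · rank 4 · open · by planner
why it might fail: Existence of the full pointwise limit, rotation invariance and inversion covariance are each open on ℤ³ (DuminilCopinICM2022 §8.1, §8.4); ScaleCovarianceNotMoebius (in tree, _holds) shows Euclidean+scale covariance alone never forces inversion, so a genuinely conformal input is needed.
sources: DuminilCopinICM2022, PolandRychkovVichi2019, Literature.Barriers.CriticalPhenomena.ScaleCovarianceNotMoebius, Literature.Probability.LatticeModels.CritIsing3DEuclideanLimit
[crux] r5 = MoebLim (IMPORTED COMPLEMENT, lowest rank): the critical Ising correlators on ℤ³ have a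
non-degenerate pointwise scaling limit (ρ > 0 on (0,1], Δ > 0, S) that is Möbius covariant with
dimension Δ — the conjunct Ising3DConformalLimit minus clause (iii). Written verbatim as the
conjunct's definiens without '∧ HasNontrivialU4 S' so that other routes filing the same complement
attach here. This route does not attack existence, rotation or inversion covariance; it bets on the
covariance lines (IsingEuclidUpgrade r5/r6 = items 0637/0638, IsingCFTData r2 = 0665, cards
hyperoctahedral-rp-rigidity / inversion-first-moebius-from-translations). S may be taken 0 off
NonCoincident, so no coincident-configuration junk obstructs the existential. -/
@[route_item "route-CriticalPhenomena-EnergyNotSigmaSquared"]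
def MoebiusLimit : Prop :=
  ∃ (ρ : ℝ → ℝ) (Δ : ℝ) (S : Literature.Probability.LatticeModels.CorrFamily 3), (∀ δ ∈ Set.Ioc (0:ℝ) 1, 0 < ρ δ) ∧ 0 < Δ ∧ Literature.Probability.LatticeModels.HasPointwiseScalingLimit (Literature.Probability.LatticeModels.criticalCorr 3) ρ S ∧ Literature.Probability.LatticeModels.IsNondegenerateTwoPoint S ∧ Literature.Probability.LatticeModels.IsMoebiusCovariant Δ S

-- earlier RungOneAdjacentMerging (stmt-CriticalPhenomena-4470, replaced 2026-08-15T16:55:06Z -> stmt-CriticalPhenomena-11262): retired by None — ∀ ε : ℝ, 0 < ε → ∃ R : ℝ, ∀ x : Literature.Probability.LatticeModels.Site 3, R ≤ ‖x‖ → ∃ n₀ : ℕ, ∀ n : ℕ, n₀ ≤ n → ∀ o a y y' : Literature.Probability.LatticeModels.BoxVertex 3 n, (o : Literature.Probability.LatticeModels.Site 3) = 0 → (a : Literature.Proba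
/-- item stmt-CriticalPhenomena-11262 · crux · rank 5 · closed · proved by Summit.CriticalPhenomena.Ising3DConformalLimit.RungOneAdjacentMergingDominantShell.RungOneAdjacentMerging_of @ cb5f6e8f7c7d (prover) · by planner
why it might fail: False verbatim for d≥5 (finite bubble: adjacent duplicated clusters avoid with probability ≥c, Aizenman 1982); on ℤ³ B(β_c)=∞ (DCP25 Thm 1.8) gives only E[#common vertices]→∞; P[disjoint]→0 also needs cross-shell decorrelation E[N_jN_k]≲EN_j·EN_k (ratio regularity / ADC-type mixing), unknown on ℤ³.
sources: AizenmanDuminilCopinAnnals2021, DuminilCopinPanis2025LowerBounds, AizenmanCMP1982, MessagerMiracleSoleJSP1977, Literature.Probability.LatticeModels.Current.tsum_prodWeight_mul_interCount, Literature.Probability.LatticeModels.Current.sq_mul_tsum_prodWeight_mul_interCount_sq_le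
(RUNG 1 of the card, the duplicated system; off the assembly chain by design — it is the calibration
of the whole line and a kill criterion) in the free-boundary box Λ_n of ℤ³ at β_c(3) — the
nearest-neighbour graph of ℤ³ induced on box 3 n, in Lean `(zdGraph 3).comap Subtype.val` on ↥(box 3
n) (rev-2 restatement over RandomCurrents vocabulary only; rev 1 used freeBoxGraph 3 n = the same
bonds plus the isolated outer layer box 3 (n+1) ∖ box 3 n, immaterial since n → ∞ first) — let
(n₁,n₃) ~ P^(0x,∅) and (n₂,n₄) ~ P^(e₂ x+e₂,∅) be independent pairs of currents
(doubleCurrentMeasure); then the probability that the clusters C_(n₁+n₃)(0) and C_(n₂+n₄)(e₂) are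
DISJOINT — in Lean: no vertex u with 0 ↔ u in n₁+n₃ and e₂ ↔ u in n₂+n₄ (tracedConn), provably the
same event as Disjoint (Current.cluster (n₁+n₃) 0) (Current.cluster (n₂+n₄) e₂) (ext + simp
[mem_tracedConn_iff, mem_cluster_iff, Finset.disjoint_left]; SketchEquiv.lean in the route evidence)
— tends to 0 as ‖x‖ → ∞ (n → ∞ first): duplicated strands tied at neighbouring nails always end up
touching. First moments are exact (P^(0x,∅)[u ∈ C(0)] = ⟨σ₀σ_u⟩⟨σ_uσ_x⟩/⟨σ₀σ_x⟩, in tree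
tsum_epairWeight_mul_indicator_mem_cluster, WeightedCurr -/
@[route_item "route-CriticalPhenomena-EnergyNotSigmaSquared"]
def RungOneAdjacentMerging : Prop :=
  ∀ ε : ℝ, 0 < ε → ∃ R : ℝ, ∀ x : Literature.Probability.LatticeModels.Site 3, R ≤ ‖x‖ → ∃ n₀ : ℕ, ∀ n : ℕ, n₀ ≤ n → ∀ o a y y' : ↥(Literature.Probability.LatticeModels.box 3 n), (o : Literature.Probability.LatticeModels.Site 3) = 0 → (a : Literature.Probability.LatticeModels.Site 3) = Pi.single 1 1 → (y : Literature.Probability.LatticeModels.Site 3) = x → (y' : Literature.Probability.LatticeModels.Site 3) = x + Pi.single 1 1 → ((Literature.Probability.LatticeModels.doubleCurrentMeasure ((Literature.Probability.LatticeModels.zdGraph 3).comap (Subtype.val : ↥(Literature.Probability.LatticeModels.box 3 n) → Literature.Probability.LatticeModels.Site 3)) (Literature.Probability.LatticeModels.criticalBeta 3) (symmDiff {o} {y}) ∅).prod (Literature.Probability.LatticeModels.doubleCurrentMeasure ((Literature.Probability.LatticeModels.zdGraph 3).comap (Subtype.val : ↥(Literature.Probability.LatticeModels.box 3 n) → Literature.Probability.LatticeModels.Site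 3)) (Literature.Probability.LatticeModels.criticalBeta 3) (symmDiff {a} {y'}) ∅)).real {pq | ∀ u : ↥(Literature.Probability.LatticeModels.box 3 n), ¬ (pq.1 ∈ Literature.Probability.LatticeModels.tracedConn ((Literature.Probability.LatticeModels.zdGraph 3).comap (Subtype.val : ↥(Literature.Probability.LatticeModels.box 3 n) → Literature.Probability.LatticeModels.Site 3)) o u ∧ pq.2 ∈ Literature.Probability.LatticeModels.tracedConn ((Literature.Probability.LatticeModels.zdGraph 3).comap (Subtype.val : ↥(Literature.Probability.LatticeModels.box 3 n) → Literature.Probability.LatticeModels.Site 3)) a u)} ≤ ε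

-- `RungOneAdjacentMerging` holds: proved by `Summit.CriticalPhenomena.Ising3DConformalLimit.RungOneAdjacentMergingDominantShell.RungOneAdjacentMerging_of` @ cb5f6e8f7c7d (its module imports this route file, so no `_holds` link can be stated here).

/-- item stmt-CriticalPhenomena-4471 · support · rank 9 · closed · proved by Summit.CriticalPhenomena.Ising3DConformalLimit.FKParityRobustnessFarMergingGivesU4.farMergingGivesU4_proof (prover) · by planner
sources: Literature.Probability.LatticeModels.HasPointwiseScalingLimit, Literature.Probability.LatticeModels.HasNontrivialU4, AizenmanCMP1982
[support] (GLUE, provable now) far merging along infinitely many dilations of a fixed injective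
lattice shape x forces item 0636: for every ρ > 0 on (0,1] and S with HasPointwiseScalingLimit
(criticalCorr 3) ρ S and IsNondegenerateTwoPoint S, HasNontrivialU4 S. Proof: take the continuum
configuration y = x (cast to ℝ³) and meshes δ_j = 1/L_j along the dilations; latticeApprox δ_j y =
L_j x exactly, so ρ(δ_j)⁴U₄^latt(L_jx) → limitConnectedFour S y and ρ(δ_j)²⟨σσ⟩ → S 2 at the two
pairs (pointwise convergence at the non-coincident y, no continuity of S needed); the lattice
inequality gives limitConnectedFour S y ≤ −c S₂(y₀,y₁)S₂(y₂,y₃) < 0. [difficulty: provable-now] -/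
@[route_item "route-CriticalPhenomena-EnergyNotSigmaSquared"]
def FarMergingGivesU4 : Prop :=
  (∃ c : ℝ, 0 < c ∧ ∃ x : Fin 4 → Literature.Probability.LatticeModels.Site 3, Function.Injective x ∧ ∀ L₀ : ℕ, ∃ L : ℕ, L₀ ≤ L ∧ Literature.Probability.LatticeModels.criticalCorr 3 4 (fun i => (L : ℤ) • x i) - (Literature.Probability.LatticeModels.criticalCorr 3 2 ![(L : ℤ) • x 0, (L : ℤ) • x 1] * Literature.Probability.LatticeModels.criticalCorr 3 2 ![(L : ℤ) • x 2, (L : ℤ) • x 3] + Literature.Probability.LatticeModels.criticalCorr 3 2 ![(L : ℤ) • x 0, (L : ℤ) • x 2] * Literature.Probability.LatticeModels.criticalCorr 3 2 ![(L : ℤ) • x 1, (L : ℤ) • x 3] + Literature.Probability.LatticeModels.criticalCorr 3 2 ![(L : ℤ) • x 0, (L : ℤ) • x 3] * Literature.Probability.LatticeModels.criticalCorr 3 2 ![(L : ℤ) • x 1, (L : ℤ) • x 2]) ≤ -(c * (Literature.Probability.LatticeModels.criticalCorr 3 2 ![(L : ℤ) • x 0, (L : ℤ) • x 1] * Literature.Probability.LatticeModels.criticalCorr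 3 2 ![(L : ℤ) • x 2, (L : ℤ) • x 3]))) → ∀ (ρ : ℝ → ℝ) (S : Literature.Probability.LatticeModels.CorrFamily 3), (∀ δ ∈ Set.Ioc (0:ℝ) 1, 0 < ρ δ) → Literature.Probability.LatticeModels.HasPointwiseScalingLimit (Literature.Probability.LatticeModels.criticalCorr 3) ρ S → Literature.Probability.LatticeModels.IsNondegenerateTwoPoint S → Literature.Probability.LatticeModels.HasNontrivialU4 S

/-- `FarMergingGivesU4` holds: proved by `Summit.CriticalPhenomena.Ising3DConformalLimit.FKParityRobustnessFarMergingGivesU4.farMergingGivesU4_proof`. -/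
theorem FarMergingGivesU4_holds : FarMergingGivesU4 := _root_.Summit.CriticalPhenomena.Ising3DConformalLimit.FKParityRobustnessFarMergingGivesU4.farMergingGivesU4_proof

/-- item stmt-CriticalPhenomena-4472 · support · rank 9 · closed · proved by Summit.CriticalPhenomena.Ising3DConformalLimit.Theorems.EnergyFactorisation_proof @ cbf57c235ebf (prover) · by planner
sources: Literature.Probability.LatticeModels.ursellFour_eq_doubleCurrent_holds, Literature.Probability.LatticeModels.isingCorr_mul_eq_doubleCurrent_subcurrent_holds, AizenmanCMP1982, DuminilCopin2016
[support] (card A1, the exact line; provable now from ursellFour_eq_doubleCurrent_holds applied to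
the two pairings (a,x|b,y) and (a,y|b,x), symmetry of connectedFour, and
isProbabilityMeasure_doubleCurrentMeasure_holds where the two-point prefactor is non-zero) for the
n.n. Ising model with free boundary condition and zero field on any finite graph, β ≥ 0 and vertices
a b x y: ⟨σ_aσ_bσ_xσ_y⟩ − ⟨σ_aσ_b⟩⟨σ_xσ_y⟩ = ⟨σ_aσ_x⟩⟨σ_bσ_y⟩·P^ax⊗P^by[a ↮ b in n₁+n₂] +
⟨σ_aσ_y⟩⟨σ_bσ_x⟩·P^ay⊗P^bx[a ↮ b in n₁+n₂]. With (a,b) = (0,e₂) a bond and (x,y) = (x,x+e₂) this is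
⟨ε₀;ε_x⟩ = G²·A^par + G'²·A^cross. [difficulty: provable-now] -/
@[route_item "route-CriticalPhenomena-EnergyNotSigmaSquared"]
def EnergyFactorisation : Prop :=
  ∀ (V : Type) [Fintype V] [DecidableEq V] (G : SimpleGraph V) [DecidableRel G.Adj] (β : ℝ), 0 ≤ β → ∀ a b x y : V, Literature.Probability.LatticeModels.nPoint (Literature.Probability.LatticeModels.isingMeasure G Finset.univ β 0 .free) Literature.Probability.LatticeModels.spinAt ![a, b, x, y] - Literature.Probability.LatticeModels.isingTwoPoint G Finset.univ β 0 .free a b * Literature.Probability.LatticeModels.isingTwoPoint G Finset.univ β 0 .free x y = Literature.Probability.LatticeModels.isingTwoPoint G Finset.univ β 0 .free a x * Literature.Probability.LatticeModels.isingTwoPoint G Finset.univ β 0 .free b y * (Literature.Probability.LatticeModels.doubleCurrentMeasure G β (symmDiff {a} {x}) (symmDiff {b} {y})).real (Literature.Probability.LatticeModels.tracedConn G a b)ᶜ + Literature.Probability.LatticeModels.isingTwoPoint G Finset.univ β 0 .free a y * Literature.Probability.LatticeModels.isingTwoPoint G Finset.univ β 0 .free b x * (Literature.Probability.LatticeModels.doubleCurrentMeasure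 G β (symmDiff {a} {y}) (symmDiff {b} {x})).real (Literature.Probability.LatticeModels.tracedConn G a b)ᶜ

-- `EnergyFactorisation` holds: proved by `Summit.CriticalPhenomena.Ising3DConformalLimit.Theorems.EnergyFactorisation_proof` @ cbf57c235ebf (its module imports this route file, so no `_holds` link can be stated here).

/-- item stmt-CriticalPhenomena-4473 · support · rank 9 · open · by planner
sources: AizenmanDuminilCopinAnnals2021, DuminilCopinPanis2025LowerBounds, DuminilCopin2016
[support] (soft gap, the first milestone of EnergyGapPowerLaw: "ε ≠ :σ²: on ℤ³")
⟨σ₀σ_e₂;σ_xσ_x+e₂⟩_β_c = o(⟨σ₀σ_x⟩²_β_c) as ‖x‖ → ∞. Intended proof: EnergyFactorisation +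
FATNESS-LITE on infinitely many shells (Σ_(u∈S_k) P^0x[u ∈ C_n₁(0)]² ≥ cΣ_(u∈S_k)G(u)²) + the
RungOne second moment; strictly weaker than GAP, not used by the assembly. [difficulty: L] -/
@[route_item "route-CriticalPhenomena-EnergyNotSigmaSquared"]
def EnergyGapSoft : Prop :=
  ∀ ε : ℝ, 0 < ε → ∃ R : ℝ, ∀ x : Literature.Probability.LatticeModels.Site 3, R ≤ ‖x‖ → Literature.Probability.LatticeModels.criticalCorr 3 4 ![0, (Pi.single 1 1 : Literature.Probability.LatticeModels.Site 3), x, x + Pi.single 1 1] - Literature.Probability.LatticeModels.criticalCorr 3 2 ![0, (Pi.single 1 1 : Literature.Probability.LatticeModels.Site 3)] * Literature.Probability.LatticeModels.criticalCorr 3 2 ![x, x + Pi.single 1 1] ≤ ε * Literature.Probability.LatticeModels.criticalTwoPoint 3 x ^ 2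

/-- item stmt-CriticalPhenomena-14286 · support · rank 10 · closed · proved by Summit.CriticalPhenomena.Ising3DConformalLimit.Theorems.cruxesGiveTarget_proof @ a341fb9aa2cf (prover) · by planner
sources: AizenmanCMP1982, DuminilCopinICM2022
[support] (GLUE to the target; pure logic, provable now by `fun hT hGap hGl hML => ⟨hGap, hT, hGl,
hML⟩` — planner Sketch.lean rc 0) the four chain items give the thesis X = Target (= GAP ∧ TRANSFER
∧ GLUE ∧ ML, the four definientia inlined) verbatim; filed so that Target is reachable from the
cruxes in the obligation graph (D-0019/A11 badge route.target-unreachable). Rank 10 (not 9) only so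
that the decl renders after the rank-9 supports it names (FarMergingGivesU4); it carries no
mathematics and is not a crux. Supersedes stmt-CriticalPhenomena-14161 TargetFromCruxes (same glue
at rank 9, unrenderable: forward reference). Converse bookkeeping, also pure logic and not filed:
Target → Ising3DConformalLimit (Sketch.lean `target_suffices`). [deps: GapForcesFarMerging,
EnergyGapPowerLaw, FarMergingGivesU4, MoebiusLimit] [difficulty: provable-now] -/
@[route_item "route-CriticalPhenomena-EnergyNotSigmaSquared"]
def CruxesGiveTarget : Prop :=
  GapForcesFarMerging → EnergyGapPowerLaw → FarMergingGivesU4 → MoebiusLimit → Target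

-- `CruxesGiveTarget` holds: proved by `Summit.CriticalPhenomena.Ising3DConformalLimit.Theorems.cruxesGiveTarget_proof` @ a341fb9aa2cf (its module imports this route file, so no `_holds` link can be stated here).

/-- item stmt-CriticalPhenomena-4474 · assembly · rank 1 · closed · proved by Summit.CriticalPhenomena.Ising3DConformalLimit.Theorems.Assembly_proof @ a38e75902643 (prover) · by planner
sources: AizenmanCMP1982, DuminilCopinICM2022
[assembly] EnergyGapPowerLaw → GapForcesFarMerging → FarMergingGivesU4 → MoebiusLimit →
Ising3DConformalLimit. -/
@[route_item "route-CriticalPhenomena-EnergyNotSigmaSquared"]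
def Assembly : Prop :=
  EnergyGapPowerLaw → GapForcesFarMerging → FarMergingGivesU4 → MoebiusLimit → Ising3DConformalLimit

-- `Assembly` holds: proved by `Summit.CriticalPhenomena.Ising3DConformalLimit.Theorems.Assembly_proof` @ a38e75902643 (its module imports this route file, so no `_holds` link can be stated here).

/-! D-0027 §2.1 — DECIDING THEOREM (planner-authored via `route open/edit --closes-file`; by planner-rbadge-CriticalPhenomena-EnergyNotSigm-7ca3a36f-0 2026-08-16T03:14:00Z):
its hypotheses are this route's items and its conclusion the sub-problem Statement (glue_lint), and it elaborates with this file. -/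

@[closes "route-CriticalPhenomena-EnergyNotSigmaSquared"] theorem closes (hGap : EnergyGapPowerLaw) (hTransfer : GapForcesFarMerging)
    (hGlue : FarMergingGivesU4) (hML : MoebiusLimit) : _root_.Ising3DConformalLimit := by
  obtain ⟨ρ, Δ, S, hρ, hΔ, hlim, hnd, hmob⟩ := hML
  exact ⟨ρ, Δ, S, hρ, hΔ, hlim, hnd, hmob, hGlue (hTransfer hGap) ρ S hρ hlim hnd⟩

end Summit.CriticalPhenomena.Ising3DConformalLimit.Theses.EnergyNotSigmaSquared
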